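import Summits.QuantumFields.YangMills.Theorems.BalabanUVNodesN06AtRecord11CB10YZW
import Literature.MathematicalPhysics.QuantumFieldTheory.Balaban1983to89.Node00.Record11CarriersB8Sub

/-!
# BalabanUVNodes ∕ N06 ([B9], `Dag.B9_main`) RE-KEYED AT NODE 00's SIX-PIN STAGE-11 RECORDS `IsRecordOfRecord₁₁CB10YZWB8B12` and
# `IsRecordOfRecord₁₁CB10YZWB8subB12` — the one-line re-key (trigger t1 of the seat's HANDOFF): readings, ∀-closers from the bundle slot, pointed ∃-faces

Track A of `YM-PLAN.md` (cell `pub-ymgap`, HUMAN RULING D-0062), node **N06** = [Balaban1985BackgroundPropagators] Thms 3.1–3.15; seat `pub-ymgap-dag-n06-d` gen 2.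
node00-def g32 landed two further Stage-11 records with THE SAME datum as def-T's `Record11`: `IsRecordOfRecord₁₁CB10YZWB8B12` (`Node00/Record11CarriersB12`, p454379:
all six typed carrier groups pinned, [B12 §§2–5] innermost; a same-datum-same-world refinement of g31's five-pin `…B8`) and `IsRecordOfRecord₁₁CB10YZWB8subB12`
(`Node00/Record11CarriersB8Sub`: the [B8] group re-keyed over the sub-index; same-datum COMPANION in `…₁₁CB10YZW`, leaves equal off `b8`).  This module carries the
(W2) closer set of N06 (`BalabanUVNodesN06AtRecord11CB10YZW`, p449575) to both, BY NAME — the [B9] face at either record is def-Y's extended leaf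
`B9LeafX (Y9OfRecord N θ.toStage3Params M⋆ ops)` at the bundle of record (THE GENUINE LATTICE NORMS (3.39)–(3.41) `geo9Y`, backgrounds `bg9Y`, the operator layer `ops`
residual), read off g32's `leaves_iff_of_…` ∕ `upOfRecord₅CS_view₁₁B12B8(sub)B10YZW_leaves`; the in-edges `b4 b5 b6 b7` are NODE 00 theorems at every run
(g31 ∕ g32's `b4_b5_b6_b7_of_…`).  Kernel bookkeeping: 0 `def`, 0 `sorry`, standard axioms.  COUNT-NEUTRAL; `--supports` K1 `StabilityBAtRecordR11e`.

WHAT THIS MODULE PROVES.  §1 the generic re-key `s_N06_of_refines₁₁CB10YZWB8` (every record predicate refining the five-pin `…B8` with the same world) and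
`s_N06_record₁₁CB10YZWB8B12_of_bundleSlot`; the reading `b9_main_iff_leafX_of_isRecordOfRecord₁₁CB10YZWB8B12`; the pointed ∃-currency face over the six-pin view
`b9_main_of_up_view₁₁B12B8B10YZW`.  §2 the same three at `…B8subB12` (`s_N06_record₁₁CB10YZWB8subB12_of_bundleSlot`, `b9_main_iff_leafX_of_…B8subB12`,
`b9_main_of_up_view₁₁B12B8subB10YZW`).

HONEST FRAMING.  Nothing of [B9] is proved for Bałaban's operators; every closer takes the leaf at the bundle of record AS A HYPOTHESIS (the bundle slot quantifies over
the HIDDEN operator layer — `N06AtRecord11CB10YZW` §3 says what that costs); N06 is NOT discharged; one finite four-torus programme at fixed `ε` — NOT ℝ⁴, NOT OS, NOT a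
mass gap, NOT Clay.  Restate-immune (no `def`).
-/

noncomputable section

namespace Summit.QuantumFields.YangMills.BalabanUVNodes.N06AtRecord11SixPin

open Literature.MathematicalPhysics.QuantumFieldTheory.Balaban1983to89
open Literature.MathematicalPhysics.QuantumFieldTheory.Balaban1983to89.T4Continuum (T4Family FiniteEpsData)
open Literature.MathematicalPhysics.QuantumFieldTheory.Balaban1983to89.DagBinding (WorldP leavesP B9LeafX)
open Literature.MathematicalPhysics.QuantumFieldTheory.Balaban1983to89.Node00
open YMDAG.UVSplit (RecordPred Datum AtRecord S_N06)
open Summit.QuantumFields.YangMills.BalabanUVNodes.N06AtRecord11CB10YZW (s_N06_record₁₁CB10YZWB8_of_bundleSlot)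
open scoped Matrix.Norms.L2Operator

variable {N : ℕ} [NeZero N]

/-! ## §1 the six-pin record `IsRecordOfRecord₁₁CB10YZWB8B12` ([B12 §§2–5] innermost; same datum, same world as `…B8`) -/

/-- **`S_N06 Rec` FOR EVERY RECORD PREDICATE REFINING THE FIVE-PIN RECORD `IsRecordOfRecord₁₁CB10YZWB8`** (same datum, same world), from the bundle slot — the re-key
recipe for the S-binding pins (`…B8B12` below, and the next ones). [cite: Balaban1985BackgroundPropagators, Thms 3.1–3.15 pp.397–432 (bookkeeping); Balaban1985RegularSpaces, Thm 8 p.101 (the [B8] pin)] -/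
theorem s_N06_of_refines₁₁CB10YZWB8 (Rec : RecordPred N)
    (href : ∀ (F : T4Family) (D : Datum F N) (w : WorldP), Rec F D w → IsRecordOfRecord₁₁CB10YZWB8 F N D w)
    (hslot : ∀ (θ₃ : Stage3Params), θ₃.toStage1Params.Admissible → ∀ (Mstar : ℕ) (ops : OpsY N θ₃ Mstar), B9LeafX (Y9OfRecord N θ₃ Mstar ops)) :
    S_N06 Rec :=
  fun F D w hR P => s_N06_record₁₁CB10YZWB8_of_bundleSlot hslot F D w (href F D w hR) P

/-- **`S_N06` AT THE SIX-PIN STAGE-11 RECORD `IsRecordOfRecord₁₁CB10YZWB8B12`**, from the bundle slot, through g32's same-datum-same-world refinement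
`isRecordOfRecord₁₁CB10YZWB8_of_isRecordOfRecord₁₁CB10YZWB8B12`. [cite: Balaban1985BackgroundPropagators, Thms 3.1–3.15 pp.397–432; Balaban1987RG1, Lemma 4 p.280 (the [B12] pin; bookkeeping)] -/
theorem s_N06_record₁₁CB10YZWB8B12_of_bundleSlot
    (hslot : ∀ (θ₃ : Stage3Params), θ₃.toStage1Params.Admissible → ∀ (Mstar : ℕ) (ops : OpsY N θ₃ Mstar), B9LeafX (Y9OfRecord N θ₃ Mstar ops)) :
    S_N06 (fun F D w => IsRecordOfRecord₁₁CB10YZWB8B12 F N D w) :=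
  s_N06_of_refines₁₁CB10YZWB8 _ (fun _ _ _ h => isRecordOfRecord₁₁CB10YZWB8_of_isRecordOfRecord₁₁CB10YZWB8B12 h) hslot

section SixPin

variable {F : T4Family} {D : FiniteEpsData F (Node00.SU N)} {w : WorldP}

/-- **At a `…B8B12` record N06 IS def-Y's EXTENDED LEAF AT THE [B9] BUNDLE OF RECORD** of the presenting package: `Dag.B9_main (leavesP w P) ↔ B9LeafX (Y9OfRecord N
θ.toStage3Params M⋆ ops)` at every run (g32's `leaves_iff_of_isRecordOfRecord₁₁CB10YZWB8B12`; the in-edges `b4 b5 b6 b7` hold by g31's `b4_b5_b6_b7_of_isRecordOfRecord₁₁CB10YZWB8`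
after the refinement).  Only `ops` and `M⋆` are residual in the bundle. [cite: Balaban1985BackgroundPropagators, Thms 3.1–3.15 pp.397–432, (3.39)–(3.41) p.397; Balaban1987RG1, Lemma 4 p.280 (bookkeeping)] -/
theorem b9_main_iff_leafX_of_isRecordOfRecord₁₁CB10YZWB8B12 (h : IsRecordOfRecord₁₁CB10YZWB8B12 F N D w) :
    ∃ (θ : Stage11Params F N) (Mstar : ℕ) (ops : OpsY N θ.toStage3Params Mstar), θ.Admissible ∧ w.L = (θ.L : ℝ) ∧
      ∀ P : B12.RunParams, Dag.B9_main (leavesP w P) ↔ B9LeafX (Y9OfRecord N θ.toStage3Params Mstar ops) := by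
  obtain ⟨θ, lam12, lam, Mstar, ops, ζ, lamW, hθ, hL, hl⟩ := leaves_iff_of_isRecordOfRecord₁₁CB10YZWB8B12 h
  refine ⟨θ, Mstar, ops, hθ, hL, fun P => ?_⟩
  obtain ⟨h4, h5, h6, h7⟩ := b4_b5_b6_b7_of_isRecordOfRecord₁₁CB10YZWB8 (isRecordOfRecord₁₁CB10YZWB8_of_isRecordOfRecord₁₁CB10YZWB8B12 h) P
  exact ⟨fun hm => ((hl P).2.2.2.1).1 (hm h4 h5 h6 h7), fun hleaf _ _ _ _ => ((hl P).2.2.2.1).2 hleaf⟩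

/-- **N06 AT ANY WORLD BOUND OVER THE SIX-PIN STAGE-11 VIEW `view₁₁B12B8B10YZW`, FROM def-Y's LEAF AT THE CHOSEN PACKAGE** (the pointed ∃-currency of K1 at the six-pin
view: g32's `upOfRecord₅CS_view₁₁B12B8B10YZW_leaves`; in-edges unused). [cite: Balaban1985BackgroundPropagators, Thms 3.1–3.15 pp.397–432; Balaban1987RG1, Lemma 4 p.280 (bookkeeping)] -/
theorem b9_main_of_up_view₁₁B12B8B10YZW (θ : Stage11Params F N) (lam12 : ResidB12 F N θ.τ9.M) (lam : ResidB8 θ.toStage3Params) (Mstar : ℕ)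
    (ops : OpsY N θ.toStage3Params Mstar) (ζ : ResidZ F N) (lamW : ResidW F N) (w : WorldP)
    (hup : ∀ P, w.up P = upOfRecord₅CS F N (θ.view₁₁B12B8B10YZW F N lam12 lam Mstar ops ζ lamW) P)
    (hleaf : B9LeafX (Y9OfRecord N θ.toStage3Params Mstar ops)) (P : B12.RunParams) : Dag.B9_main (leavesP w P) := by
  intro _ _ _ _
  show (w.up P).b9
  rw [hup P]
  exact (upOfRecord₅CS_view₁₁B12B8B10YZW_leaves F N θ lam12 lam Mstar ops ζ lamW P).2.2.2.1.2 hleaf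

/-! ## §2 the six-pin record `IsRecordOfRecord₁₁CB10YZWB8subB12` ([B8] over the sub-index; same-datum companion in `…₁₁CB10YZW`) -/

/-- **`S_N06` AT THE SIX-PIN STAGE-11 RECORD `IsRecordOfRecord₁₁CB10YZWB8subB12`**, from the bundle slot: at such a record `b9 ↔ B9LeafX (Y9OfRecord …)` for the presenting
package (g32's `leaves_iff_of_isRecordOfRecord₁₁CB10YZWB8subB12`), so the slot closes `Dag.B9_main` (in-edges unused).
[cite: Balaban1985BackgroundPropagators, Thms 3.1–3.15 pp.397–432; Balaban1985RegularSpaces, Thm 8 p.101; Balaban1987RG1, Lemma 4 p.280 (the pins; bookkeeping)] -/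
theorem s_N06_record₁₁CB10YZWB8subB12_of_bundleSlot
    (hslot : ∀ (θ₃ : Stage3Params), θ₃.toStage1Params.Admissible → ∀ (Mstar : ℕ) (ops : OpsY N θ₃ Mstar), B9LeafX (Y9OfRecord N θ₃ Mstar ops)) :
    S_N06 (fun F D w => IsRecordOfRecord₁₁CB10YZWB8subB12 F N D w) := by
  intro F D w h P _ _ _ _
  obtain ⟨θ, lam12, lam, Mstar, ops, ζ, lamW, hθ, -, hl⟩ := leaves_iff_of_isRecordOfRecord₁₁CB10YZWB8subB12 h
  exact ((hl P).2.2.2.1).2 (hslot θ.toStage3Params hθ.1.1.1.1.1 Mstar ops)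

/-- **At a `…B8subB12` record N06 IS def-Y's EXTENDED LEAF AT THE [B9] BUNDLE OF RECORD** of the presenting package (g32's `leaves_iff_of_isRecordOfRecord₁₁CB10YZWB8subB12`;
the in-edges hold by g32's `b4_b5_b6_b7_of_isRecordOfRecord₁₁CB10YZWB8subB12`, via the companion). [cite: Balaban1985BackgroundPropagators, Thms 3.1–3.15 pp.397–432, (3.39)–(3.41) p.397; Balaban1985RegularSpaces, Thm 8 p.101 (bookkeeping)] -/
theorem b9_main_iff_leafX_of_isRecordOfRecord₁₁CB10YZWB8subB12 (h : IsRecordOfRecord₁₁CB10YZWB8subB12 F N D w) :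
    ∃ (θ : Stage11Params F N) (Mstar : ℕ) (ops : OpsY N θ.toStage3Params Mstar), θ.Admissible ∧ w.L = (θ.L : ℝ) ∧
      ∀ P : B12.RunParams, Dag.B9_main (leavesP w P) ↔ B9LeafX (Y9OfRecord N θ.toStage3Params Mstar ops) := by
  obtain ⟨θ, lam12, lam, Mstar, ops, ζ, lamW, hθ, hL, hl⟩ := leaves_iff_of_isRecordOfRecord₁₁CB10YZWB8subB12 h
  refine ⟨θ, Mstar, ops, hθ, hL, fun P => ?_⟩
  obtain ⟨h4, h5, h6, h7⟩ := b4_b5_b6_b7_of_isRecordOfRecord₁₁CB10YZWB8subB12 h P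
  exact ⟨fun hm => ((hl P).2.2.2.1).1 (hm h4 h5 h6 h7), fun hleaf _ _ _ _ => ((hl P).2.2.2.1).2 hleaf⟩

/-- **N06 AT ANY WORLD BOUND OVER THE SIX-PIN VIEW `view₁₁B12B8subB10YZW`, FROM def-Y's LEAF AT THE CHOSEN PACKAGE** (pointed ∃-currency; g32's
`upOfRecord₅CS_view₁₁B12B8subB10YZW_leaves`; in-edges unused). [cite: Balaban1985BackgroundPropagators, Thms 3.1–3.15 pp.397–432; Balaban1985RegularSpaces, Thm 8 p.101 (bookkeeping)] -/
theorem b9_main_of_up_view₁₁B12B8subB10YZW (θ : Stage11Params F N) (lam12 : ResidB12 F N θ.τ9.M) (lam : ResidB8 θ.toStage3Params) (Mstar : ℕ)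
    (ops : OpsY N θ.toStage3Params Mstar) (ζ : ResidZ F N) (lamW : ResidW F N) (w : WorldP)
    (hup : ∀ P, w.up P = upOfRecord₅CS F N (θ.view₁₁B12B8subB10YZW F N lam12 lam Mstar ops ζ lamW) P)
    (hleaf : B9LeafX (Y9OfRecord N θ.toStage3Params Mstar ops)) (P : B12.RunParams) : Dag.B9_main (leavesP w P) := by
  intro _ _ _ _
  show (w.up P).b9
  rw [hup P]
  exact (upOfRecord₅CS_view₁₁B12B8subB10YZW_leaves F N θ lam12 lam Mstar ops ζ lamW P).2.2.2.1.2 hleaf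

end SixPin

end Summit.QuantumFields.YangMills.BalabanUVNodes.N06AtRecord11SixPin

end
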